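import Summits.HodgeConjecture.CorCM.MultiFieldWeilGaloisHeadlines
import Mathlib.Algebra.Polynomial.SpecificDegree
import HarnessLib

/-!
# MULTI-FIELD WEIL ENGINE — THE CUBIC TOWER: ANY NUMBER of `(1,2)`-threefolds over sextic CM fields sharing `k`, each field admitting NO `k`-embedding
# into the compositum of the previous ones — the Hodge conjecture for every product of copies, given ONLY Markman's fourfold theorem; THREE threefolds

Cell `pub-hodgecm2` (COR-CM), seat b30 gen 32 (2026-08-24); count-neutral own lane MULTI-FIELD WEIL ENGINE (stem `MultiFieldWeil*`), sequel of
`CorCM/MultiFieldWeilNonIsomorphicSextics.lean` (gen 31, G3: TWO relative cubics with `Hom(K₁, K₀) = ∅`) and `CorCM/MultiFieldWeilGaloisHeadlines.lean` (G2b,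
`hodgeConjectureFor_biproduct_comp_of_sextics_of_finrank`: any number of sextic fields, hypothesis = the DEGREE `2 · 3^r` of one compositum).  Theorems only; no
definition, no named fact, no `sorry`.  HONEST FRAMING: conditional on the displayed Markman fourfold binder only; `HC_CM` is NOT proved and not asserted.

WHY.  For THREE or more sextic CM fields `K_m = k · F_m` sharing the imaginary quadratic field `k`, pairwise non-isomorphy does NOT make the relative cubics
linearly disjoint (two linearly disjoint CYCLIC cubics `K_0, K_1` over `k` have compositum with group `C₃ × C₃`, which contains two further cubic subextensions,
non-isomorphic to `K_0`, `K_1` and to each other).  The honest `r`-field form of G3's "no homomorphism" hypothesis is a TOWER condition: no `k`-embedding of `K_m` into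
the compositum of (the chosen images of) `K_0, …, K_{m−1}`.  For relative cubics this is exactly linear disjointness, field by field, because a cubic with no root is
irreducible — so the degree hypothesis of G2b is discharged by `r` non-embedding checks.  (For relative QUINTICS the one-step argument needs both sides of degree `5`
— `CorCM/MultiFieldWeilQuinticDisjoint.lean` — and no tower form is claimed.)

* §1 **`finrank_sup_adjoin_range_of_forall_not_range_subset`** — ONE CUBIC STEP over an ARBITRARY base: `A ⊂ ℂ` of finite degree containing `τ(k)`, `[K : k] = 3`,
  `s` an embedding of `K` over `τ`; if no embedding of `K` over `τ` has image inside `A`, then `[A · s(K) : ℚ] = 3 [A : ℚ]` (the transported minimal polynomial of a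
  primitive element is a cubic with no root in `A` — a root `γ` would be the `k`-embedding `K = k(β) → A`, `β ↦ γ`, Mathlib `algHomAdjoinIntegralEquiv` — hence
  irreducible, `Polynomial.irreducible_of_degree_le_three_of_not_isRoot`).  G3's lemma is the case `A = ℚ(s₀ K₀)`.
* §2 **`finrank_adjoin_iUnion_of_cubicTower`** — induction on `r`: under the tower condition `[ℚ(τk) · s_0(K_0) ⋯ s_{r−1}(K_{r−1}) : ℚ] = 3^r [k : ℚ]`;
  `not_range_subset_adjoin_range` (the condition at `m = 0` is automatic: `[K_0 : ℚ] > [k : ℚ]`).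
* §3 **`hodgeConjectureFor_biproduct_comp_of_sextics_of_cubicTower`** (+ dominated) — THE HEADLINE: `E = A 0 ⊨ (k; {τ})` and ANY NUMBER of `(1,2)`-threefolds
  `T_m ⊨ (K_m; Φ_m)` over sextic `K_m ∋ k` satisfying the tower condition: the Hodge conjecture for EVERY product of copies `E^a × ∏ T_m^{b_m}`, GIVEN ONLY
  `Markman2025_weilClasses_algebraic_abelianFourfold`.
* §4 **`hodgeConjectureFor_biproduct_comp_of_three_sextics`** — THREE threefolds with the hypotheses spelled out: `Hom(K_1, K_0) = ∅` and no `τ`-embedding of `K_2`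
  into `ℚ(τk) · s₀(K_0) · s₁(K_1)` (`nonempty_ringHom_of_range_subset`: an embedding landing in `ℚ(τk) · s₀(K_0) = s₀(K_0)` factors through `K_0`).

[cite: Markman2025SurveySecant, Thm. 1.2] [cite: Lang2002, V §1 Prop. 1.2, VI §1 Thm. 1.1, Cor. 1.6 and V §2 Thm. 2.8] [cite: Shimura1998, §18.2 Lemma (i)]

## References
* [Markman2025SurveySecant] E. Markman, arXiv:2509.23403, Thm. 1.2 (the fourfold Weil-class theorem, displayed binder).  [Lang2002] S. Lang, *Algebra*, GTM 211,
  V §1 Prop. 1.2 (tower law), V §2 Thm. 2.8 (extension of embeddings), VI §1 Thm. 1.1 and Cor. 1.6.  [Shimura1998] G. Shimura, *Abelian varieties with complex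
  multiplication and modular functions*, §18.2 Lemma (i).
-/

noncomputable section

open CategoryTheory CategoryTheory.Limits NumberField IntermediateField Polynomial

namespace Summit.HodgeConjecture.CorCM.MultiFieldWeil

open Finset
open Literature.AlgebraicGeometry Literature.AlgebraicGeometry.Motives Literature.AlgebraicGeometry.HodgeTheory
open Literature.AlgebraicGeometry.ComplexMultiplication (IsCMTypeRealisation)
open Literature.AlgebraicTopology.SingularHomology
open Literature.NumberTheory.ComplexMultiplication

open scoped Classical

/-! ## §1 One step: a relative cubic with no `τ`-embedding into `A` is linearly disjoint from `A` -/

section Step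

variable {k K : Type} [Field k] [NumberField k] [Field K] [NumberField K]

/-- **ONE CUBIC STEP OVER AN ARBITRARY BASE.**  `i : k → K` with `[K : ℚ] = 3 [k : ℚ]`; `A ⊂ ℂ` a subfield of finite degree containing `τ(k)`; `s : K → ℂ` an
embedding over `τ`.  If NO embedding `φ : K → ℂ` over `τ` takes all its values in `A` (no `k`-embedding of `K` into `A`), then `[A · s(K) : ℚ] = 3 [A : ℚ]`.
(The minimal polynomial over `k` of a primitive element `β` of `K`, transported to `A` along `τ`, is a cubic with no root in `A` — a root `γ` would give the
`k`-embedding `K = k(β) → A`, `β ↦ γ` — hence irreducible over `A` (Mathlib `Polynomial.irreducible_of_degree_le_three_of_not_isRoot`), so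
`[A(sβ) : A] = 3`.)  The case `A = ℚ(s₀ K₀)` is gen 31's `finrank_adjoin_pair_of_isEmpty_ringHom`. [cite: Lang2002, V §1 Prop. 1.2, VI §1 Thm. 1.1 and V §2 Thm. 2.8] -/
theorem finrank_sup_adjoin_range_of_forall_not_range_subset (i : k →+* K) (h₃ : Module.finrank ℚ K = 3 * Module.finrank ℚ k)
    (A : IntermediateField ℚ ℂ) [FiniteDimensional ℚ A] {τ : k →+* ℂ} (hτA : ∀ x, τ x ∈ A) {s : K →+* ℂ} (hs : s.comp i = τ)
    (hK : ∀ φ : K →+* ℂ, φ.comp i = τ → ¬ Set.range φ ⊆ (A : Set ℂ)) :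
    Module.finrank ℚ ↥(A ⊔ adjoin ℚ (Set.range s)) = 3 * Module.finrank ℚ A := by
  letI : Algebra k K := i.toAlgebra
  haveI : IsScalarTower ℚ k K := IsScalarTower.of_algebraMap_eq fun q => by
    rw [RingHom.algebraMap_toAlgebra, eq_ratCast, eq_ratCast, map_ratCast]
  haveI : FiniteDimensional k K := FiniteDimensional.right ℚ k K
  have hk3 : Module.finrank k K = 3 := by
    have h := Module.finrank_mul_finrank ℚ k K
    rw [h₃, mul_comm 3] at h
    exact Nat.eq_of_mul_eq_mul_left Module.finrank_pos h
  let τA : k →+* A := τ.codRestrict A hτA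
  letI : Algebra k A := τA.toAlgebra
  -- a primitive element `β` of `K` over `ℚ`, its image `b`, and its minimal polynomial `q` over `k` (a cubic)
  obtain ⟨β, hβ⟩ := Field.exists_primitive_element ℚ K
  set b : ℂ := s β with hb
  have hβint : IsIntegral k β := IsIntegral.of_finite k β
  have hβtop : k⟮β⟯ = ⊤ := by
    rw [eq_top_iff]
    intro x _
    have hx : x ∈ ℚ⟮β⟯ := by rw [hβ]; exact mem_top
    have hle : ℚ⟮β⟯ ≤ (k⟮β⟯).restrictScalars ℚ := adjoin_le_iff.2 (Set.singleton_subset_iff.2 (mem_adjoin_simple_self k β))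
    exact hle hx
  set q : k[X] := minpoly k β with hq
  have hqdeg : q.natDegree = 3 := by
    rw [hq, ← adjoin.finrank hβint, hβtop, finrank_top', hk3]
  -- its transport `q'` to `A` along `τ` has the root `b`
  set q' : (A : Type)[X] := q.map τA with hq'
  have hq'monic : q'.Monic := (minpoly.monic hβint).map τA
  have hq'deg : q'.natDegree = 3 := by rw [hq', (minpoly.monic hβint).natDegree_map, hqdeg]
  have hq'b : aeval b q' = 0 := by
    have h1 : (algebraMap A ℂ).comp τA = τ := RingHom.ext fun x => rfl
    rw [aeval_def, hq', eval₂_map, h1, ← hs, hb, ← Polynomial.hom_eval₂, ← RingHom.algebraMap_toAlgebra i, ← aeval_def, hq, minpoly.aeval, map_zero]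
  -- and NO root in `A`: a root `γ` gives the `k`-embedding `K = k(β) → A`, `β ↦ γ`
  have hq'root : ∀ γ : A, ¬ q'.IsRoot γ := by
    intro γ hγ
    have hmem : γ ∈ (minpoly k β).aroots A := by
      rw [mem_aroots, ← hq]
      refine ⟨minpoly.ne_zero hβint, ?_⟩
      rw [aeval_def, RingHom.algebraMap_toAlgebra, ← Polynomial.eval_map, ← hq']
      exact hγ.eq_zero
    let φ₀ : k⟮β⟯ →ₐ[k] A := (algHomAdjoinIntegralEquiv k hβint).symm ⟨γ, hmem⟩
    let e : K ≃ₐ[k] k⟮β⟯ := IntermediateField.topEquiv.symm.trans (IntermediateField.equivOfEq hβtop.symm)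
    let φ : K →+* ℂ := (algebraMap A ℂ).comp (φ₀.toRingHom.comp e.toAlgHom.toRingHom)
    refine hK φ (RingHom.ext fun x => ?_) ?_
    · change (algebraMap A ℂ) (φ₀ (e (i x))) = τ x
      have h1 : i x = algebraMap k K x := rfl
      rw [h1, AlgEquiv.commutes, AlgHom.commutes]
      rfl
    · rintro y ⟨x, rfl⟩
      exact (φ₀ (e x)).2
  -- hence `q'` is irreducible (a cubic) and is the minimal polynomial of `b` over `A`: `[A(b) : A] = 3`
  have hq'irr : Irreducible q' :=
    irreducible_of_degree_le_three_of_not_isRoot (by rw [hq'deg]; exact Finset.mem_Icc.2 ⟨by norm_num, le_rfl⟩) hq'root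
  have hbint : IsIntegral A b := ⟨q', hq'monic, by rwa [aeval_def] at hq'b⟩
  have hminb : (minpoly A b).natDegree = 3 := by
    rw [← minpoly.eq_of_irreducible_of_monic hq'irr hq'b hq'monic, hq'deg]
  have hAb : Module.finrank A A⟮b⟯ = 3 := by rw [adjoin.finrank hbint, hminb]
  -- the compositum is `A(b)`
  have hsb : Set.range s ⊆ (ℚ⟮b⟯ : IntermediateField ℚ ℂ) := by
    rintro y ⟨x, rfl⟩
    have hx : x ∈ ℚ⟮β⟯ := by rw [hβ]; exact mem_top
    have h : s.toRatAlgHom x ∈ (ℚ⟮β⟯).map s.toRatAlgHom := (IntermediateField.map_mem_map ℚ⟮β⟯ s.toRatAlgHom).2 hx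
    rw [IntermediateField.adjoin_map, Set.image_singleton] at h
    exact h
  have hres : (A⟮b⟯).restrictScalars ℚ = A ⊔ ℚ⟮b⟯ := restrictScalars_adjoin_eq_sup ℚ A _
  have hF : A ⊔ adjoin ℚ (Set.range s) = A ⊔ ℚ⟮b⟯ :=
    le_antisymm (sup_le_sup_left (adjoin_le_iff.2 hsb) A)
      (sup_le_sup_left (adjoin.mono ℚ ({b} : Set ℂ) (Set.range s) (Set.singleton_subset_iff.2 ⟨β, hb.symm⟩)) A)
  have hmul := Module.finrank_mul_finrank ℚ A A⟮b⟯
  rw [hAb] at hmul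
  have hfin : Module.finrank ℚ ↥(A ⊔ ℚ⟮b⟯) = Module.finrank ℚ A⟮b⟯ := by
    rw [← hres]
    rfl
  rw [hF, hfin, ← hmul, mul_comm]

end Step

/-! ## §2 The tower: `r` relative cubics, each with no `τ`-embedding into the compositum of the earlier ones -/

section Tower

variable {k : Type} [Field k] [NumberField k]

/-- **An embedding of a bigger field does not land in `ℚ(τk)`.**  If `[K : ℚ] > [k : ℚ]` then no embedding `φ : K → ℂ` has `φ(K) ⊆ ℚ(τ(k))` (degrees).
[folklore] -/
theorem not_range_subset_adjoin_range {K : Type} [Field K] [NumberField K] (hlt : Module.finrank ℚ k < Module.finrank ℚ K) (τ : k →+* ℂ) (φ : K →+* ℂ) :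
    ¬ Set.range φ ⊆ (adjoin ℚ (Set.range τ) : Set ℂ) := by
  intro h
  haveI : FiniteDimensional ℚ ↥(adjoin ℚ (Set.range τ)) :=
    Module.finite_of_finrank_pos (by rw [finrank_adjoin_range_ringHom]; exact Module.finrank_pos)
  have hle : adjoin ℚ (Set.range φ) ≤ adjoin ℚ (Set.range τ) := adjoin_le_iff.2 h
  have h1 := IntermediateField.finrank_le_of_le_right hle
  rw [finrank_adjoin_range_ringHom, finrank_adjoin_range_ringHom] at h1
  omega

/-- **THE CUBIC TOWER.**  `K_0, …, K_{r−1} ⊇ k` number fields of relative degree `3` with embeddings `s_m` over `τ : k → ℂ`; suppose that for every `m` NO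
embedding of `K_m` over `τ` takes its values in the compositum `ℚ(τk) · s_0(K_0) ⋯ s_{m−1}(K_{m−1})` of the earlier images (no `k`-embedding of `K_m` into that
compositum).  Then `[ℚ(τk) · s_0(K_0) ⋯ s_{r−1}(K_{r−1}) : ℚ] = 3^r [k : ℚ]`: the `K_m` are linearly disjoint over `k`.  (Induction on `r` by
`finrank_sup_adjoin_range_of_forall_not_range_subset`.)  For `r = 2` the hypothesis is `Hom_k(K_1, K_0) = ∅` (gen 31's `finrank_adjoin_pair_of_isEmpty_ringHom`);
for `r = 3` pairwise conditions do NOT suffice (a third cubic inside the compositum of the Galois closures of two linearly disjoint ones). [cite: Lang2002, V §1 Prop. 1.2, VI §1 Thm. 1.1 and V §2 Thm. 2.8] -/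
theorem finrank_adjoin_iUnion_of_cubicTower (r : ℕ) :
    ∀ {K : Fin r → Type} [∀ m, Field (K m)] [∀ m, NumberField (K m)] (i : ∀ m, k →+* K m)
      (h₃ : ∀ m, Module.finrank ℚ (K m) = 3 * Module.finrank ℚ k) {τ : k →+* ℂ} (s : ∀ m, K m →+* ℂ) (hs : ∀ m, (s m).comp (i m) = τ)
      (hK : ∀ m (φ : K m →+* ℂ), φ.comp (i m) = τ →
        ¬ Set.range φ ⊆ (↑(adjoin ℚ (Set.range τ) ⊔ adjoin ℚ (⋃ j : {j : Fin r // j < m}, Set.range (s j.1))) : Set ℂ)),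
      Module.finrank ℚ ↥(adjoin ℚ (Set.range τ) ⊔ adjoin ℚ (⋃ m, Set.range (s m))) = 3 ^ r * Module.finrank ℚ k := by
  induction r with
  | zero =>
    intro K _ _ i h₃ τ s hs hK
    rw [Set.iUnion_of_empty, adjoin_empty, sup_bot_eq, finrank_adjoin_range_ringHom, pow_zero, one_mul]
  | succ r ih =>
    intro K _ _ i h₃ τ s hs hK
    -- the compositum `A` of the first `r` images, of degree `3^r [k : ℚ]` by induction
    set A : IntermediateField ℚ ℂ := adjoin ℚ (Set.range τ) ⊔ adjoin ℚ (⋃ m : Fin r, Set.range (s (Fin.castSucc m))) with hAdef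
    have hA : Module.finrank ℚ A = 3 ^ r * Module.finrank ℚ k := by
      refine ih (K := fun m => K (Fin.castSucc m)) (fun m => i (Fin.castSucc m)) (fun m => h₃ _) (fun m => s (Fin.castSucc m)) (fun m => hs _)
        fun m φ hφ hsub => hK (Fin.castSucc m) φ hφ (hsub.trans ?_)
      refine SetLike.coe_subset_coe.2 (sup_le_sup_left (adjoin.mono ℚ _ _ (Set.iUnion_subset fun j => ?_)) _)
      exact Set.subset_iUnion_of_subset (⟨Fin.castSucc j.1, Fin.castSucc_lt_castSucc_iff.2 j.2⟩ : {j' : Fin (r + 1) // j' < Fin.castSucc m})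
        Set.Subset.rfl
    haveI : FiniteDimensional ℚ A := Module.finite_of_finrank_pos (by rw [hA]; exact mul_pos (pow_pos (by norm_num) r) Module.finrank_pos)
    have hτA : ∀ x, τ x ∈ A := fun x => (le_sup_left : adjoin ℚ (Set.range τ) ≤ A) (subset_adjoin ℚ _ ⟨x, rfl⟩)
    -- the last field is linearly disjoint from `A`
    have hlast : ∀ φ : K (Fin.last r) →+* ℂ, φ.comp (i (Fin.last r)) = τ → ¬ Set.range φ ⊆ (A : Set ℂ) := by
      intro φ hφ hsub
      refine hK (Fin.last r) φ hφ (hsub.trans (SetLike.coe_subset_coe.2 (sup_le_sup_left (adjoin.mono ℚ _ _ (Set.iUnion_subset fun m => ?_)) _)))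
      exact Set.subset_iUnion_of_subset (⟨Fin.castSucc m, Fin.castSucc_lt_last m⟩ : {j' : Fin (r + 1) // j' < Fin.last r}) Set.Subset.rfl
    have hstep := finrank_sup_adjoin_range_of_forall_not_range_subset (i (Fin.last r)) (h₃ _) A hτA (hs (Fin.last r)) hlast
    -- the whole compositum is `A · s_last(K_last)`
    have hU : (⋃ m : Fin (r + 1), Set.range (s m)) = (⋃ m : Fin r, Set.range (s (Fin.castSucc m))) ∪ Set.range (s (Fin.last r)) := by
      ext x
      simp only [Set.mem_iUnion, Set.mem_union]
      exact Fin.exists_fin_succ'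
    rw [hU, adjoin_union, ← sup_assoc, hstep, hA, pow_succ]
    ring

end Tower

/-! ## §3 The headlines: any number of `(1,2)`-threefolds over a cubic tower of sextic CM fields; three threefolds -/

section Engine

variable {I : Type} {r : ℕ} {Kf : I → Type} [∀ i, Field (Kf i)] [∀ i, NumberField (Kf i)] [∀ i, IsCMField (Kf i)]
  {i₀ : I} {is : Fin r → I} {τ : Kf i₀ →+* ℂ}
  {A : Fin (r + 1) → AbelianVariety ℂ} {Φ : ∀ j : Fin (r + 1), CMType (Kf (mfSlots i₀ is j))}
  {ι : ∀ j, 𝓞 (Kf (mfSlots i₀ is j)) →+* End (A j)}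
  {θ : ∀ j, Kf (mfSlots i₀ is j) →+* Module.End ℂ (complexBetti (A j).X 1)}

/-- **ANY NUMBER OF `(1,2)`-THREEFOLDS OVER A CUBIC TOWER OF SEXTIC CM FIELDS — given ONLY Markman's fourfold theorem.**  `E = A 0 ⊨ (k; {τ})`, `k = Kf i₀`
imaginary quadratic; `T_m = A (m+1) ⊨ (K_m; Φ (m+1))` over SEXTIC `K_m = Kf (is m) ⊇ im m (k)` with ONE member of `Φ (m+1)` over `τ`; a family `s₀` of
`τ`-embeddings such that for every `m` NO `τ`-embedding of `K_m` takes its values in `ℚ(τk) · s₀_0(K_0) ⋯ s₀_{m−1}(K_{m−1})`.  Then the Hodge conjecture holds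
for EVERY product of copies `⨁_j A (κ j)` — `E^a × T_0^{b_0} × ⋯ × T_{r−1}^{b_{r−1}}`.  (G2b's `hodgeConjectureFor_biproduct_comp_of_sextics_of_finrank` with the
degree `2 · 3^r` supplied by `finrank_adjoin_iUnion_of_cubicTower`.)  `HC_CM` is NOT asserted. [cite: Markman2025SurveySecant, Thm. 1.2]
[cite: Lang2002, VI §1 Thm. 1.1, Cor. 1.6 and V §2 Thm. 2.8] [cite: Shimura1998, §18.2 Lemma (i)] -/
theorem hodgeConjectureFor_biproduct_comp_of_sextics_of_cubicTower (hW4 : Markman2025_weilClasses_algebraic_abelianFourfold)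
    {N : ℕ} (κ : Fin N → Fin (r + 1)) (h2 : Module.finrank ℚ (Kf i₀) = 2) (h6 : ∀ m : Fin r, Module.finrank ℚ (Kf (is m)) = 6)
    (im : ∀ m : Fin r, Kf i₀ →+* Kf (is m)) (hA : ∀ j, IsCMTypeRealisation (Φ j) (A j) (ι j) (θ j)) (hΨ : ∀ σ : Kf i₀ →+* ℂ, σ ∈ (Φ 0).1 ↔ σ = τ)
    (h1 : ∀ m : Fin r, (Finset.univ.filter fun s : Kf (is m) →+* ℂ => s.comp (im m) = τ ∧ s ∈ (Φ m.succ).1).card = 1)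
    (s₀ : ∀ m : Fin r, Kf (is m) →+* ℂ) (hs₀ : ∀ m, (s₀ m).comp (im m) = τ)
    (htower : ∀ (m : Fin r) (φ : Kf (is m) →+* ℂ), φ.comp (im m) = τ →
      ¬ Set.range φ ⊆ (↑(adjoin ℚ (Set.range τ) ⊔ adjoin ℚ (⋃ j : {j : Fin r // j < m}, Set.range (s₀ j.1))) : Set ℂ)) :
    HodgeConjectureFor (⨁ fun j => A (κ j)).dim (⨁ fun j => A (κ j)).X :=
  hodgeConjectureFor_biproduct_comp_of_sextics_of_finrank hW4 κ h2 h6 im hA hΨ h1 s₀ hs₀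
    (by rw [finrank_adjoin_iUnion_of_cubicTower r im (fun m => by rw [h6 m, h2]) s₀ hs₀ htower, h2, mul_comm])

/-- **Dominated form** of `hodgeConjectureFor_biproduct_comp_of_sextics_of_cubicTower`. [cite: Markman2025SurveySecant, Thm. 1.2] -/
theorem hodgeConjectureFor_of_avDominatedBy_comp_of_sextics_of_cubicTower (hW4 : Markman2025_weilClasses_algebraic_abelianFourfold)
    {N : ℕ} (κ : Fin N → Fin (r + 1)) (h2 : Module.finrank ℚ (Kf i₀) = 2) (h6 : ∀ m : Fin r, Module.finrank ℚ (Kf (is m)) = 6)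
    (im : ∀ m : Fin r, Kf i₀ →+* Kf (is m)) (hA : ∀ j, IsCMTypeRealisation (Φ j) (A j) (ι j) (θ j)) (hΨ : ∀ σ : Kf i₀ →+* ℂ, σ ∈ (Φ 0).1 ↔ σ = τ)
    (h1 : ∀ m : Fin r, (Finset.univ.filter fun s : Kf (is m) →+* ℂ => s.comp (im m) = τ ∧ s ∈ (Φ m.succ).1).card = 1)
    (s₀ : ∀ m : Fin r, Kf (is m) →+* ℂ) (hs₀ : ∀ m, (s₀ m).comp (im m) = τ)
    (htower : ∀ (m : Fin r) (φ : Kf (is m) →+* ℂ), φ.comp (im m) = τ →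
      ¬ Set.range φ ⊆ (↑(adjoin ℚ (Set.range τ) ⊔ adjoin ℚ (⋃ j : {j : Fin r // j < m}, Set.range (s₀ j.1))) : Set ℂ))
    {X : AbelianVariety ℂ} (hX : Domination.AVDominatedBy X (⨁ fun j => A (κ j))) : HodgeConjectureFor X.dim X.X :=
  Domination.hodgeConjectureFor_of_avDominatedBy (hodgeConjectureFor_biproduct_comp_of_sextics_of_cubicTower hW4 κ h2 h6 im hA hΨ h1 s₀ hs₀ htower) hX

end Engine

/-! ## §4 Three `(1,2)`-threefolds: `Hom(K₁, K₀) = ∅` and no `k`-embedding of `K₂` into `K₀ · K₁` -/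

section Three

variable {I : Type} {Kf : I → Type} [∀ i, Field (Kf i)] [∀ i, NumberField (Kf i)] [∀ i, IsCMField (Kf i)]
  {i₀ : I} {is : Fin 3 → I} {τ : Kf i₀ →+* ℂ}
  {A : Fin (3 + 1) → AbelianVariety ℂ} {Φ : ∀ j : Fin (3 + 1), CMType (Kf (mfSlots i₀ is j))}
  {ι : ∀ j, 𝓞 (Kf (mfSlots i₀ is j)) →+* End (A j)}
  {θ : ∀ j, Kf (mfSlots i₀ is j) →+* Module.End ℂ (complexBetti (A j).X 1)}

/-- **An embedding landing in the image of another factors through it.**  If `φ, s₀ : K', K → ℂ` are embeddings of number fields with `φ(K') ⊆ ℚ(τk) · s₀(K)`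
(`τ = s₀ ∘ i₀`), then there is a ring homomorphism `K' → K`. [folklore] -/
theorem nonempty_ringHom_of_range_subset {k K K' : Type} [Field k] [Field K] [NumberField K] [Field K'] (i₀ : k →+* K) {τ : k →+* ℂ}
    {s₀ : K →+* ℂ} (hs₀ : s₀.comp i₀ = τ) (φ : K' →+* ℂ) (h : Set.range φ ⊆ (↑(adjoin ℚ (Set.range τ) ⊔ adjoin ℚ (Set.range s₀)) : Set ℂ)) :
    Nonempty (K' →+* K) := by
  have hA : adjoin ℚ (Set.range τ) ⊔ adjoin ℚ (Set.range s₀) = s₀.toRatAlgHom.fieldRange := by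
    rw [← adjoin_range_ringHom_eq_fieldRange]
    refine le_antisymm (sup_le (adjoin.mono ℚ _ _ ?_) le_rfl) le_sup_right
    rintro y ⟨x, rfl⟩
    exact ⟨i₀ x, by rw [← hs₀]; rfl⟩
  have hmem : ∀ x, φ x ∈ s₀.toRatAlgHom.fieldRange := fun x => by rw [← hA]; exact h ⟨x, rfl⟩
  let e := (AlgEquiv.ofInjectiveField s₀.toRatAlgHom).symm
  exact ⟨e.toRingEquiv.toRingHom.comp (φ.codRestrict s₀.toRatAlgHom.fieldRange.toSubfield hmem)⟩

/-- **THREE `(1,2)`-THREEFOLDS OVER SEXTIC CM FIELDS SHARING `k` — given ONLY Markman's fourfold theorem.**  `E = A 0 ⊨ (k; {τ})`; `T_m = A (m+1) ⊨ (K_m; Φ (m+1))`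
(`m : Fin 3`) over SEXTIC `K_m ⊇ im m (k)` with one member of the type over `τ`; HYPOTHESES: `Hom(K_1, K_0) = ∅` (non-isomorphic), and for `τ`-embeddings
`s₀_0, s₀_1` of `K_0, K_1` NO `τ`-embedding of `K_2` takes its values in `ℚ(τk) · s₀_0(K_0) · s₀_1(K_1)` (no `k`-embedding of `K_2` into the compositum —
pairwise non-isomorphy is NOT enough).  Then the Hodge conjecture holds for EVERY product of copies `E^a × T_0^b × T_1^c × T_2^d`.  `HC_CM` is NOT asserted.
[cite: Markman2025SurveySecant, Thm. 1.2] [cite: Lang2002, VI §1 Thm. 1.1, Cor. 1.6 and V §2 Thm. 2.8] [cite: Shimura1998, §18.2 Lemma (i)] -/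
theorem hodgeConjectureFor_biproduct_comp_of_three_sextics (hW4 : Markman2025_weilClasses_algebraic_abelianFourfold)
    {N : ℕ} (κ : Fin N → Fin (3 + 1)) (h2 : Module.finrank ℚ (Kf i₀) = 2) (h6 : ∀ m : Fin 3, Module.finrank ℚ (Kf (is m)) = 6)
    (im : ∀ m : Fin 3, Kf i₀ →+* Kf (is m)) (hA : ∀ j, IsCMTypeRealisation (Φ j) (A j) (ι j) (θ j)) (hΨ : ∀ σ : Kf i₀ →+* ℂ, σ ∈ (Φ 0).1 ↔ σ = τ)
    (h1 : ∀ m : Fin 3, (Finset.univ.filter fun s : Kf (is m) →+* ℂ => s.comp (im m) = τ ∧ s ∈ (Φ m.succ).1).card = 1)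
    (hK : IsEmpty (Kf (is 1) →+* Kf (is 0))) (s₀ : Kf (is 0) →+* ℂ) (s₁ : Kf (is 1) →+* ℂ) (hs₀ : s₀.comp (im 0) = τ) (hs₁ : s₁.comp (im 1) = τ)
    (hK₂ : ∀ φ : Kf (is 2) →+* ℂ, φ.comp (im 2) = τ → ¬ Set.range φ ⊆ (↑(adjoin ℚ (Set.range τ) ⊔ adjoin ℚ (Set.range s₀ ∪ Set.range s₁)) : Set ℂ)) :
    HodgeConjectureFor (⨁ fun j => A (κ j)).dim (⨁ fun j => A (κ j)).X := by
  -- a `τ`-embedding of the third field, and the family `t = (s₀, s₁, s₂)`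
  obtain ⟨s₂, hs₂⟩ : ∃ s : Kf (is 2) →+* ℂ, s.comp (im 2) = τ := by
    have hc := SexticOcticWeil.card_filter_comp_eq_of_finrank (n := 3) (im 2) (by rw [h6 2]) h2 τ
    obtain ⟨s, hs⟩ := Finset.card_pos.1 (by rw [hc]; norm_num)
    exact ⟨s, (Finset.mem_filter.1 hs).2⟩
  let t : ∀ m : Fin 3, Kf (is m) →+* ℂ := fun m => match m with
    | ⟨0, _⟩ => s₀
    | ⟨1, _⟩ => s₁
    | ⟨2, _⟩ => s₂
  have ht : ∀ m, (t m).comp (im m) = τ := fun m => by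
    fin_cases m
    · exact hs₀
    · exact hs₁
    · exact hs₂
  refine hodgeConjectureFor_biproduct_comp_of_sextics_of_cubicTower hW4 κ h2 h6 im hA hΨ h1 t ht fun m φ hφ hsub => ?_
  fin_cases m
  · -- `m = 0`: the compositum of no field is `ℚ(τk)`, too small
    refine not_range_subset_adjoin_range (by rw [h6, h2]; norm_num) τ φ (hsub.trans (SetLike.coe_subset_coe.2 ?_))
    refine sup_le le_rfl (adjoin_le_iff.2 (Set.iUnion_subset fun j => ?_))
    exact absurd j.2 (by simp)
  · -- `m = 1`: the compositum is `ℚ(s₀ K₀)`; an embedding of `K₁` into it gives `K₁ → K₀`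
    refine hK.false (Classical.choice (nonempty_ringHom_of_range_subset (im 0) hs₀ φ (hsub.trans (SetLike.coe_subset_coe.2 ?_))))
    refine sup_le_sup_left (adjoin_le_iff.2 (Set.iUnion_subset fun j => ?_)) _
    obtain ⟨j, hj⟩ := j
    have hj0 : j = 0 := by
      fin_cases j
      · rfl
      · exact absurd hj (by decide)
      · exact absurd hj (by decide)
    subst hj0
    exact subset_adjoin ℚ _
  · -- `m = 2`: the compositum is `ℚ(τk) · s₀(K₀) · s₁(K₁)`
    refine hK₂ φ hφ (hsub.trans (SetLike.coe_subset_coe.2 (sup_le_sup_left (adjoin.mono ℚ _ _ (Set.iUnion_subset fun j => ?_)) _)))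
    obtain ⟨j, hj⟩ := j
    fin_cases j
    · exact Set.subset_union_left
    · exact Set.subset_union_right
    · exact absurd hj (by decide)

end Three

end Summit.HodgeConjecture.CorCM.MultiFieldWeil

end
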